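import Mathlib
import Summits.AtomisticToContinuum.Crystallization.Theorems.PhononSlackCertificatesPeriodicGivenLayeredLayerCake1

/-!
# Layered Barlow window sets: static geometry
(for `stub_layeredHullPoint`, line `nnf-door` of crux `ChartedPlanarOrder.CleanBallPlanarOrder`, stmt-32136)

decomp-a2c · lens-3 · g7.  The layered sets
`S(A, a, s, z) = A {i u + j v + haggLabel s m · w + z m · e₃ : m i j ∈ ℤ}` (the inline family of
`HullMinimality.LayeredWindows` / `NashClassCertificates.NashNearField`; Hägg letters `s`, layer heights `z` with
gaps in `[39a/50, 17a/20]`) are written INLINE, as in `LayeredHull.cake_separated`, through a defining hypothesis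
`hS : S = {p | …}`.  Proved here (static geometry only; the hull-point limit is the follow-up file
`ChartedPlanarOrderLayeredHullPoint`):

* `layered_sep` — `S` is `39a/50`-separated for every `a ≥ 0` (same layer: triangular lattice,
  `le_dist_barlowPos_of_ne`; different layers: `LayeredHull.cake_abs_height_diff_ge`).  This is sharper than
  `LayeredHull.cake_separated` (constant `1/2`, hypothesis `a ≥ 47/50`) and is the constant the stub needs;
* `layered_dense` — `S` is `37a/20`-dense (`a > 0`; greatest layer below the target height, in-plane rounding);
* `layered_periods` — `S` is invariant under `± A u`, `± A v`;
* the norms `‖u‖ = ‖v‖ = a`, `‖e₃‖ = 1` and the independence bound `‖v - σ u‖ ≥ 39a/50`.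

0 sorry. [HalesDSP2012, §1.3; folklore]
-/

noncomputable section

namespace Summit.AtomisticToContinuum.Crystallization.Theorems.ChartedPlanarOrderLayeredHullPoint

open Literature.MathematicalPhysics.StatisticalMechanics
open Summit.AtomisticToContinuum.Crystallization.Theorems.LayeredHull

local notation "E3" => EuclideanSpace ℝ (Fin 3)

/-! ## Norms of the generators -/

/-- `1.56 ≤ √3`. [folklore] -/
theorem sqrt_three_ge : (156 / 100 : ℝ) ≤ √3 := by
  calc (156 / 100 : ℝ) = Real.sqrt ((156 / 100) ^ 2) := (Real.sqrt_sq (by norm_num)).symm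
    _ ≤ √3 := Real.sqrt_le_sqrt (by norm_num)

/-- Norm of a vector of `ℝ³` from its three coordinates. [folklore] -/
theorem norm_eq_sqrt_coords (v : E3) : ‖v‖ = Real.sqrt (v 0 ^ 2 + v 1 ^ 2 + v 2 ^ 2) := by
  rw [EuclideanSpace.norm_eq, Fin.sum_univ_three]
  simp only [Real.norm_eq_abs, sq_abs]

/-- The norms of the layer generators: `‖u‖ = ‖v‖ = a`, `‖e₃‖ = 1` (bundled). [folklore] -/
theorem norms_generators {a : ℝ} (ha : 0 ≤ a) :
    ‖triangularVec₁ a‖ = a ∧ ‖triangularVec₂ a‖ = a ∧ ‖layerNormal (1 : ℝ)‖ = 1 := by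
  have h3 : (√3 : ℝ) ^ 2 = 3 := Real.sq_sqrt (by norm_num)
  have c₁ : triangularVec₁ a 0 = a ∧ triangularVec₁ a 1 = 0 ∧ triangularVec₁ a 2 = 0 := by
    simp [triangularVec₁]
  have c₂ : triangularVec₂ a 0 = a / 2 ∧ triangularVec₂ a 1 = a * √3 / 2 ∧ triangularVec₂ a 2 = 0 := by
    simp [triangularVec₂]
  have c₃ : layerNormal (1 : ℝ) 0 = 0 ∧ layerNormal (1 : ℝ) 1 = 0 ∧ layerNormal (1 : ℝ) 2 = 1 := by
    simp [layerNormal]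
  refine ⟨?_, ?_, ?_⟩
  · rw [norm_eq_sqrt_coords, c₁.1, c₁.2.1, c₁.2.2, show a ^ 2 + (0 : ℝ) ^ 2 + 0 ^ 2 = a ^ 2 by ring]
    exact Real.sqrt_sq ha
  · rw [norm_eq_sqrt_coords, c₂.1, c₂.2.1, c₂.2.2]
    have : (a / 2) ^ 2 + (a * √3 / 2) ^ 2 + (0 : ℝ) ^ 2 = a ^ 2 := by
      calc (a / 2) ^ 2 + (a * √3 / 2) ^ 2 + (0 : ℝ) ^ 2 = a ^ 2 / 4 + a ^ 2 * (√3) ^ 2 / 4 := by ring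
        _ = a ^ 2 := by rw [h3]; ring
    rw [this]; exact Real.sqrt_sq ha
  · rw [norm_eq_sqrt_coords, c₃.1, c₃.2.1, c₃.2.2, show (0 : ℝ) ^ 2 + 0 ^ 2 + 1 ^ 2 = 1 by ring]
    exact Real.sqrt_one

/-- Coordinates `1` and `2` are bounded by the norm in `ℝ³` (bundled form). [folklore] -/
theorem abs_coord_le_norm (v : E3) : |v 1| ≤ ‖v‖ ∧ |v 2| ≤ ‖v‖ := by
  have h1 := PiLp.norm_apply_le v 1
  have h2 := PiLp.norm_apply_le v 2
  simp only [Real.norm_eq_abs] at h1 h2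
  exact ⟨h1, h2⟩

/-- The independence bound `‖v - σ u‖ ≥ (√3/2) a ≥ 39a/50`. [folklore] -/
theorem norm_triangularVec₂_sub_smul {a : ℝ} (ha : 0 ≤ a) (σ : ℝ) :
    39 / 50 * a ≤ ‖triangularVec₂ a - σ • triangularVec₁ a‖ := by
  have h1 : (triangularVec₂ a - σ • triangularVec₁ a) 1 = a * √3 / 2 := by
    simp [triangularVec₁, triangularVec₂]
  have h2 := (abs_coord_le_norm (triangularVec₂ a - σ • triangularVec₁ a)).1
  rw [h1, abs_of_nonneg (by positivity)] at h2
  have h3 := sqrt_three_ge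
  nlinarith

/-! ## Layered points -/

/-- Third coordinate of a layered point. [folklore] -/
theorem layeredPoint_apply_two (a : ℝ) (s : ℤ → ℤ) (z : ℤ → ℝ) (m i j : ℤ) :
    (((i : ℝ) • triangularVec₁ a) + ((j : ℝ) • triangularVec₂ a) + ((haggLabel s m : ℝ) • barlowOffset a) +
      (z m • layerNormal 1) : E3) 2 = z m := by
  simp [triangularVec₁, triangularVec₂, barlowOffset, layerNormal]

/-- Same-layer differences are differences of `barlowPos` points (height parameter `0`). [folklore] -/
theorem layeredPoint_sub_same_layer (a : ℝ) (s : ℤ → ℤ) (z : ℤ → ℝ) (m i j i' j' : ℤ) :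
    (((i : ℝ) • triangularVec₁ a) + ((j : ℝ) • triangularVec₂ a) + ((haggLabel s m : ℝ) • barlowOffset a) +
      (z m • layerNormal 1) : E3) -
      (((i' : ℝ) • triangularVec₁ a) + ((j' : ℝ) • triangularVec₂ a) + ((haggLabel s m : ℝ) • barlowOffset a) +
      (z m • layerNormal 1)) = barlowPos a 0 s m i j - barlowPos a 0 s m i' j' := by
  simp only [barlowPos]; abel

/-! ## Separation, periods, density of the inline layered set -/

/-- **Uniform discreteness**: the layered set is `39a/50`-separated (`a ≥ 0`; same layer `≥ a`, different layers
`≥ 39a/50` vertically).  Sharper constant than `LayeredHull.cake_separated` (`1/2`, `a ≥ 47/50`). [folklore] -/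
theorem layered_sep {A : E3 →ₗᵢ[ℝ] E3} {a : ℝ} (ha : 0 ≤ a) {s : ℤ → ℤ} {z : ℤ → ℝ}
    (hz : ∀ m : ℤ, 39 / 50 * a ≤ z (m + 1) - z m) {S : Set E3}
    (hS : S = {p | ∃ m i j : ℤ, p = A ((((i : ℝ) • triangularVec₁ a) + ((j : ℝ) • triangularVec₂ a) +
      ((haggLabel s m : ℝ) • barlowOffset a) + (z m • layerNormal 1)))}) :
    ∀ p ∈ S, ∀ q ∈ S, p ≠ q → 39 / 50 * a ≤ dist p q := by
  subst hS
  rintro p ⟨m, i, j, rfl⟩ q ⟨m', i', j', rfl⟩ hpq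
  rw [A.isometry.dist_eq]
  by_cases hm : m = m'
  · subst hm
    have hij : (i, j) ≠ (i', j') := by
      rintro ⟨⟩
      exact hpq rfl
    have h1 := le_dist_barlowPos_of_ne a 0 s ha (k := m) hij
    rw [dist_eq_norm, layeredPoint_sub_same_layer, ← dist_eq_norm]
    linarith
  · have h1 := cake_abs_height_diff_ge a ha z hz m' m
    have hmm : (1 : ℝ) ≤ |((m : ℝ) - m')| := by
      rw [← Int.cast_sub, ← Int.cast_abs]
      exact_mod_cast Int.one_le_abs (sub_ne_zero.2 hm)
    have h2 := (abs_coord_le_norm ((((i : ℝ) • triangularVec₁ a) + ((j : ℝ) • triangularVec₂ a) +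
      ((haggLabel s m : ℝ) • barlowOffset a) + (z m • layerNormal 1) : E3) -
      (((i' : ℝ) • triangularVec₁ a) + ((j' : ℝ) • triangularVec₂ a) + ((haggLabel s m' : ℝ) • barlowOffset a) +
      (z m' • layerNormal 1)))).2
    rw [PiLp.sub_apply, layeredPoint_apply_two, layeredPoint_apply_two] at h2
    rw [dist_eq_norm]
    nlinarith

/-- **Exact in-plane periods**: the layered set is invariant under `± A u`, `± A v`. [folklore] -/
theorem layered_periods {A : E3 →ₗᵢ[ℝ] E3} {a : ℝ} {s : ℤ → ℤ} {z : ℤ → ℝ} {S : Set E3}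
    (hS : S = {p | ∃ m i j : ℤ, p = A ((((i : ℝ) • triangularVec₁ a) + ((j : ℝ) • triangularVec₂ a) +
      ((haggLabel s m : ℝ) • barlowOffset a) + (z m • layerNormal 1)))}) {p : E3} (hp : p ∈ S) :
    p + A (triangularVec₁ a) ∈ S ∧ p - A (triangularVec₁ a) ∈ S ∧
      p + A (triangularVec₂ a) ∈ S ∧ p - A (triangularVec₂ a) ∈ S := by
  subst hS
  obtain ⟨m, i, j, rfl⟩ := hp
  refine ⟨⟨m, i + 1, j, ?_⟩, ⟨m, i - 1, j, ?_⟩, ⟨m, i, j + 1, ?_⟩, ⟨m, i, j - 1, ?_⟩⟩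
  · rw [← A.map_add]; congr 1; push_cast; simp only [add_smul, one_smul]; abel
  · rw [← A.map_sub]; congr 1; push_cast; simp only [sub_smul, one_smul]; abel
  · rw [← A.map_add]; congr 1; push_cast; simp only [add_smul, one_smul]; abel
  · rw [← A.map_sub]; congr 1; push_cast; simp only [sub_smul, one_smul]; abel

/-- A linear isometry of `ℝ³` into itself is surjective. [folklore] -/
theorem linearIsometry_surjective (A : E3 →ₗᵢ[ℝ] E3) : Function.Surjective A := by
  have hinj : Function.Injective A.toLinearMap := A.injective
  have hsurj : Function.Surjective A.toLinearMap :=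
    (LinearMap.injective_iff_surjective (f := A.toLinearMap)).1 hinj
  intro w
  obtain ⟨u, hu⟩ := hsurj w
  exact ⟨u, hu⟩

/-- Planar decomposition of a vector of `ℝ³` along `u, v, e₃` after removing a multiple of `w`. [folklore] -/
theorem planar_decomposition {a : ℝ} (ha : 0 < a) (y : E3) (c : ℝ) :
    ∃ μ ν : ℝ, y = μ • triangularVec₁ a + ν • triangularVec₂ a + c • barlowOffset a + (y 2) • layerNormal 1 := by
  have h3 : (√3 : ℝ) ≠ 0 := by positivity
  refine ⟨(y 0 - c * (a / 2) - (y 1 - c * (a * √3 / 6)) / (a * √3 / 2) * (a / 2)) / a,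
    (y 1 - c * (a * √3 / 6)) / (a * √3 / 2), ?_⟩
  ext k
  fin_cases k
  · simp [triangularVec₁, triangularVec₂, barlowOffset, layerNormal]; field_simp; ring
  · simp [triangularVec₁, triangularVec₂, barlowOffset, layerNormal]; field_simp; ring
  · simp [triangularVec₁, triangularVec₂, barlowOffset, layerNormal]

/-- **Relative denseness**: the layered set is `37a/20`-dense (`a > 0`). [folklore] -/
theorem layered_dense {A : E3 →ₗᵢ[ℝ] E3} {a : ℝ} (ha : 0 < a) {s : ℤ → ℤ} {z : ℤ → ℝ}
    (hz : ∀ m : ℤ, 39 / 50 * a ≤ z (m + 1) - z m ∧ z (m + 1) - z m ≤ 17 / 20 * a) {S : Set E3}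
    (hS : S = {p | ∃ m i j : ℤ, p = A ((((i : ℝ) • triangularVec₁ a) + ((j : ℝ) • triangularVec₂ a) +
      ((haggLabel s m : ℝ) • barlowOffset a) + (z m • layerNormal 1)))}) :
    ∀ c : E3, ∃ p ∈ S, dist p c ≤ 37 / 20 * a := by
  subst hS
  intro c
  obtain ⟨y, rfl⟩ := linearIsometry_surjective A c
  -- layer selection: the greatest `m` with `z m ≤ y 2`
  have hlow : ∀ m : ℤ, ∀ k : ℕ, 39 / 50 * a * k ≤ z (m + k) - z m :=
    fun m k => cake_height_diff_ge a z (fun m => (hz m).1) m k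
  have hne : ∃ m : ℤ, z m ≤ y 2 := by
    obtain ⟨k, hk⟩ := exists_nat_gt ((z 0 - y 2) / (39 / 50 * a))
    refine ⟨-(k : ℤ), ?_⟩
    have h := hlow (-(k : ℤ)) k
    rw [show -(k : ℤ) + (k : ℤ) = 0 by ring] at h
    have hk' : z 0 - y 2 < (k : ℝ) * (39 / 50 * a) := by
      rwa [div_lt_iff₀ (by positivity)] at hk
    linarith
  have hbdd : ∃ b : ℤ, ∀ m : ℤ, z m ≤ y 2 → m ≤ b := by
    obtain ⟨k, hk⟩ := exists_nat_gt ((y 2 - z 0) / (39 / 50 * a))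
    refine ⟨k, fun m hm => ?_⟩
    by_contra hlt
    push Not at hlt
    obtain ⟨l, hl⟩ := Int.le.dest hlt.le
    have h := hlow (k : ℤ) l
    rw [hl] at h
    have h0 := hlow 0 k
    rw [zero_add] at h0
    have hk' : y 2 - z 0 < (k : ℝ) * (39 / 50 * a) := by
      rwa [div_lt_iff₀ (by positivity)] at hk
    have hl0 : (0 : ℝ) ≤ 39 / 50 * a * l := by positivity
    linarith
  obtain ⟨m, hm, hmax⟩ := Int.exists_greatest_of_bdd hbdd hne
  have hm1 : y 2 < z (m + 1) := by
    by_contra hle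
    push Not at hle
    have := hmax (m + 1) hle
    linarith
  have hzm : |z m - y 2| ≤ 17 / 20 * a := by
    rw [abs_le]; constructor <;> linarith [(hz m).2]
  -- in-plane rounding
  obtain ⟨μ, ν, hy⟩ := planar_decomposition ha y (haggLabel s m : ℝ)
  refine ⟨A ((((round μ : ℤ) : ℝ) • triangularVec₁ a) + (((round ν : ℤ) : ℝ) • triangularVec₂ a) +
    ((haggLabel s m : ℝ) • barlowOffset a) + (z m • layerNormal 1)), ⟨m, round μ, round ν, rfl⟩, ?_⟩
  rw [A.isometry.dist_eq, dist_eq_norm]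
  have hdiff : (((round μ : ℤ) : ℝ) • triangularVec₁ a) + (((round ν : ℤ) : ℝ) • triangularVec₂ a) +
      ((haggLabel s m : ℝ) • barlowOffset a) + (z m • layerNormal 1) - y =
      ((round μ : ℝ) - μ) • triangularVec₁ a + ((round ν : ℝ) - ν) • triangularVec₂ a +
        (z m - y 2) • layerNormal 1 := by
    conv_lhs => rw [hy]
    simp only [sub_smul]; abel
  rw [hdiff]
  have e1 : ‖((round μ : ℝ) - μ) • triangularVec₁ a‖ ≤ 1 / 2 * a := by
    rw [norm_smul, (norms_generators ha.le).1, Real.norm_eq_abs, abs_sub_comm]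
    exact mul_le_mul_of_nonneg_right (abs_sub_round μ) ha.le
  have e2 : ‖((round ν : ℝ) - ν) • triangularVec₂ a‖ ≤ 1 / 2 * a := by
    rw [norm_smul, (norms_generators ha.le).2.1, Real.norm_eq_abs, abs_sub_comm]
    exact mul_le_mul_of_nonneg_right (abs_sub_round ν) ha.le
  have e3 : ‖(z m - y 2) • layerNormal (1 : ℝ)‖ ≤ 17 / 20 * a := by
    rw [norm_smul, (norms_generators ha.le).2.2, mul_one, Real.norm_eq_abs]; exact hzm
  calc ‖((round μ : ℝ) - μ) • triangularVec₁ a + ((round ν : ℝ) - ν) • triangularVec₂ a +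
        (z m - y 2) • layerNormal 1‖
      ≤ ‖((round μ : ℝ) - μ) • triangularVec₁ a‖ + ‖((round ν : ℝ) - ν) • triangularVec₂ a‖ +
        ‖(z m - y 2) • layerNormal (1 : ℝ)‖ := norm_add₃_le
    _ ≤ 37 / 20 * a := by linarith

end Summit.AtomisticToContinuum.Crystallization.Theorems.ChartedPlanarOrderLayeredHullPoint

end
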